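import Summits.HodgeConjecture.HodgeConjecture.Theorems.R90S6SatakeGraphPartnerHom          -- ★ W3 (A.2)∕(A.3): `satakeGraphPartnerAlgHom` (= ξ̂_H), `graph_satakeGraphPartnerAlgHom`
import Literature.NumberTheory.Automorphic.HyperspecialUnitaryHeckeEigencharacter              -- ★ `heckeEigencharacter_apply` (`λ_β = ev_β ∘ 𝒮`), `coeff_satakeTransform_eq_zero_of_ne_neg` (antisymmetric support)
import Literature.NumberTheory.Automorphic.HyperspecialUnitarySatakeIsomorphismRankOne           -- ★ `eq_linear_three_of_rev`, `eq_linear_two_of_rev` (the rank-one lines `ℓ_k`, `ℓ′_k`)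
import Literature.NumberTheory.Automorphic.UnramifiedEigencharactersSeparate                  -- ★ `eq_of_forall_laurentEvalAt_eq` (two Laurent polynomials agreeing on `(ℂˣ)ⁿ` are equal)
import HarnessLib

/-!
# R90 · S6 «Ch. 14.1–14.5 stable trace formula» — card B3 (DAG row E1.3.6.2): SATAKE COEFFICIENTS UNDER `ξ̂_H` — THE SIGN TRANSPORT
# `(𝒮_H(ξ̂_H φ))_{ℓ′_k} = (−1)^k · (𝒮_G φ)_{ℓ_k}` for all `k ∈ ℤ` (`Theorems/R90S6SatakeCoeffGraphPartner.lean`)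

Cell `hodgecm-mathlib`, crux H413 (`stmt-HodgeConjecture-24833`), route of record `HCCMUnconditional`; programme R90-TF (brief `director/R90-BRIEF.v2.md`
1f40d54518340a35), section S6 (base `R90-C14`, dealer R90-C14-plan (g2)), seat R90-C14-p04 (g2); CARD B3 dealt BY NAME 2026-09-05T01:09:34Z (R90 bus), partner
of R90-C14-p09's (B1) `R90S6ConstantTermSatakeCoeff` ∕ (B2) (row E1.3.6.2 «constant-term identity on the diagonal tori»).  Lane
`--kind proof --supports stmt-HodgeConjecture-24833 --as helper`; THEOREMS ONLY over ★ `Theorems` ∕ Literature ∕ Mathlib carriers (no definition, no instance, no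
notation, no named fact, no kit, no `sorry`).

## THE PRINT
[Rogawski1990, §4.9 p. 55]: the map `f ↦ ξ̂_H(f) = f^H` of unramified Hecke algebras is characterised on Satake transforms by `ξ̂_H(f)^∧(z) = f^∧(−z)` (the
sign is the unramified character `μ`, `μ(ϖ) = −1`, entering `ξ_H`); the tree's ★ W3 `satakeGraphPartnerAlgHom` IS this map, DEFINED by its graph
`λ^{U(2)}_{(z,1)}(ξ̂_H φ) = λ^{U(3)}_{(−z,1,1)}(φ)` for all `z ∈ ℂˣ` (★ `graph_satakeGraphPartnerAlgHom`).  [CartierCorvallis1979, §IV (4.2)–(4.4)]: `λ_β(f) = (𝒮f)(β)`, the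
Satake transform evaluated at the torus parameter; for the quasi-split `U(3)` resp. `U(2) ≅ U(1,1)` at an inert place `𝒮f` is supported on the rank-one lines
`ℓ_k = (k, 0, −k)` resp. `ℓ′_k = (k, −k)` (antisymmetric cocharacters, ★ `coeff_satakeTransform_eq_zero_of_ne_neg`, ★ `eq_linear_three_of_rev` ∕ `eq_linear_two_of_rev`),
and `β = (−z, 1, 1)` resp. `(z, 1)` evaluates `x^{ℓ_k} ↦ (−z)^k` resp. `x^{ℓ′_k} ↦ z^k`.  Hence the graph identity reads `Σ_k c′_k z^k = Σ_k c_k (−z)^k` on `ℂˣ` for the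
two finitely supported coefficient vectors, and COMPARING COEFFICIENTS (★ `eq_of_forall_laurentEvalAt_eq`) gives the sign transport.  The `δ^{1∕2}`-weights `q^{−⟨ν,a⟩∕2}` live INSIDE the tree's
`satakeTransform` on both sides, so the identity of `𝒮`-coefficients carries no power of `√q`; the `√q`-bookkeeping re-enters only when (B2) converts coefficients to
constant terms `f^{(B)}` through (B1) (`satakeTwistExp ℓ_k = 2k` vs `satakeTwistExp ℓ′_k = k`).

## WHAT IS PROVED
* §1 (the injectivity letter, BY REUSE): ★ `Literature.NumberTheory.Automorphic.eq_of_forall_laurentEvalAt_eq` (two elements of `ℂ[ℤⁿ]` agreeing on `(ℂˣ)ⁿ` are equal,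
  Alon's Nullstellensatz road) plus **`laurentEvalAt_eq_laurentEvalAt_line_two`** — an element of `ℂ[ℤ²]` supported on the `U(1,1)` line `ℓ′_k = (k,−k)` is evaluated at
  `(β₀, β₁)` exactly as at `(β₀β₁⁻¹, 1)`, so agreement on the line `{(z,1)}` is agreement everywhere.
* §2 (adic place `w ∣ v` inert, `E_w∕F_v` unramified, binders `c hc1 v w hw hv` = ★ W3 VERBATIM; ANY datum `hd : UnramifiedLocalConjDatum (galAdicCompletionMap c hw) ϖ`, so that
  p09's generic-datum (B1) letters `(hd.satakeTransform T).coeff a` meet it BY NAME at `K = E_w`):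
  `prod_zpow_param_three` ∕ `_two` (the line parameters `(u,1,1)` ∕ `(u,1)` evaluate `x^μ ↦ u^{μ 0}`), `unitaryHeckeEigencharacterAdic_eq_sum_coeff` (`λ_β(T) = Σ_{μ} (𝒮T)_μ ∏_i β_i^{μ_i}`
  as a finite sum over the support, any rank), and the HEAD
  **`coeff_satakeTransform_satakeGraphPartner`**: for every `φ ∈ ℋ(U(J₀,3)(E_w), K₀)` and every `k ∈ ℤ`,
  `(hd.satakeTransform (ξ̂_H φ)).coeff ℓ′_k = (−1)^k · (hd.satakeTransform φ).coeff ℓ_k` (`(−1)^k` as an integer power in `ℂ`), with the `Int.negOnePow` spelling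
  `coeff_satakeTransform_satakeGraphPartner_negOnePow`.
HONEST LABEL: local spherical Hecke-algebra bookkeeping over ★ carriers; proves no printed global statement, discharges no citation; count-neutral helper until
(B2) ∕ row E1.3.6.2 consumes it.  HC_CM is proved only modulo the 7 printed citations (2 remaining named inputs: hLiu418 = stmt-HodgeConjecture-24832,
h413 = stmt-HodgeConjecture-24833) until rung 0 closes; REL ≠ ★ ≠ BUILT.

## Tree search (dedup)
`rg "coeff_satakeTransform_satakeGraphPartner|SatakeCoeffGraphPartner|laurentEvalAt_eq_laurentEvalAt_line|prod_zpow_param|unitaryHeckeEigencharacterAdic_eq_sum_coeff"` over `lean/` — no hit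
(2026-09-05T01:16Z); REUSED ★: `eq_of_forall_laurentEvalAt_eq` [UnramifiedEigencharactersSeparate :132], `graph_satakeGraphPartnerAlgHom`, `coeff_satakeTransform_eq_zero_of_ne_neg`,
`eq_linear_three_of_rev` ∕ `eq_linear_two_of_rev`, `unitaryHeckeEigencharacterAdic_eq`; Mathlib `AddMonoidAlgebra.sum_coeff_single`, `laurentEvalAt_single` (★).

## References
* [Rogawski1990] J. D. Rogawski, *Automorphic Representations of Unitary Groups in Three Variables*, Ann. of Math. Stud. 123 (1990): §4.9 p. 55 (`ξ̂_H(f)^∧(z) = f^∧(−z)`,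
  Prop. 4.9.1), §4.5 p. 50.
* [CartierCorvallis1979] P. Cartier, *Representations of 𝔭-adic groups: a survey*, PSPM 33.1 (1979): §IV (4.2)–(4.4), Thm. 4.1, Cor. 4.2.
* [Minguez2011] A. Mínguez, *Unramified representations of unitary groups*, in *On the stabilization of the trace formula* (2011): §4.
-/

set_option autoImplicit false
-- the mandated namespace repeats the single-problem summit's segment (`HodgeConjecture.HodgeConjecture`)
set_option linter.dupNamespace false

noncomputable section

open scoped Valued WithZero Matrix MatrixGroups
open NumberField IsDedekindDomain
open Literature.NumberTheory.Automorphic Literature.NumberTheory.Automorphic.HermitianLattice Literature.NumberTheory.Automorphic.UnitaryGroup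

namespace Summit.HodgeConjecture.HodgeConjecture.R90.S6

/-! ## §1 Evaluation of a line-supported Laurent polynomial of `U(1,1)` only sees the parameter `β₀∕β₁` -/

section Line

/-- **A Laurent polynomial `F ∈ ℂ[ℤ²]` supported on the `U(1,1)` line `ℓ′_k = (k, −k)` is evaluated at `β = (β₀, β₁) ∈ (ℂˣ)²` exactly as at `(β₀β₁⁻¹, 1)`**
(`β₀^k β₁^{−k} = (β₀β₁⁻¹)^k`): the unramified eigencharacters of `U(1,1)` depend on the single Satake parameter `z = β₀β₁⁻¹`.  With ★ `eq_of_forall_laurentEvalAt_eq`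
(agreement on all of `(ℂˣ)²` ⟹ equality) this is the injectivity letter of the card: two line-supported elements agreeing on the line `{(z, 1)}` are equal.
[cite: CartierCorvallis1979, §IV (4.2)–(4.4), Cor. 4.2] -/
theorem laurentEvalAt_eq_laurentEvalAt_line_two (F : AddMonoidAlgebra ℂ (Fin 2 → ℤ))
    (hF : ∀ μ, F.coeff μ ≠ 0 → μ = fun i : Fin 2 => μ 0 * (1 - 2 * ((i : ℕ) : ℤ))) (β : Fin 2 → ℂˣ) :
    laurentEvalAt β F = laurentEvalAt ![β 0 * (β 1)⁻¹, 1] F := by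
  classical
  conv_lhs => rw [← AddMonoidAlgebra.sum_coeff_single F, map_finsuppSum, Finsupp.sum]
  conv_rhs => rw [← AddMonoidAlgebra.sum_coeff_single F, map_finsuppSum, Finsupp.sum]
  refine Finset.sum_congr rfl fun μ hμ => ?_
  rw [laurentEvalAt_single, laurentEvalAt_single, hF μ (Finsupp.mem_support_iff.1 hμ), Fin.prod_univ_two, Fin.prod_univ_two]
  simp only [Fin.isValue, Fin.val_zero, Fin.val_one, Nat.cast_zero, Nat.cast_one, mul_zero, sub_zero, mul_one, Matrix.cons_val_zero,
    Matrix.cons_val_one, Units.val_one, one_zpow, Units.val_mul, Units.val_inv_eq_inv_val, mul_zpow, inv_zpow']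
  ring

end Line

/-! ## §2 The sign transport of Satake coefficients under `ξ̂_H` at an inert unramified place -/

section Adic

variable {F E : Type} [Field F] [NumberField F] [Field E] [NumberField E] [Algebra F E] [Algebra.IsQuadraticExtension F E]
  (c : E ≃ₐ[F] E) (hc1 : c ≠ 1) (v : HeightOneSpectrum (𝓞 F)) (w : PlacesOver E v) (hw : c • w.1 = w.1)
  (hv : Algebra.IsUnramifiedIn (𝓞 E) v.asIdeal)

/-- The `U(3)` line parameter `(u, 1, 1)` evaluates every exponent `μ` to `u^{μ 0}`. [cite: CartierCorvallis1979, §IV (4.2)] -/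
theorem prod_zpow_param_three (u : ℂˣ) (μ : Fin 3 → ℤ) : ∏ i, (((![u, 1, 1] : Fin 3 → ℂˣ) i : ℂˣ) : ℂ) ^ μ i = (u : ℂ) ^ μ 0 := by
  rw [Fin.prod_univ_three]
  simp only [Matrix.cons_val_zero, Matrix.cons_val_one, Matrix.cons_val_two, Matrix.tail_cons, Matrix.head_cons, Units.val_one, one_zpow, mul_one]

/-- The `U(2)` line parameter `(u, 1)` evaluates every exponent `μ` to `u^{μ 0}`. [cite: CartierCorvallis1979, §IV (4.2)] -/
theorem prod_zpow_param_two (u : ℂˣ) (μ : Fin 2 → ℤ) : ∏ i, (((![u, 1] : Fin 2 → ℂˣ) i : ℂˣ) : ℂ) ^ μ i = (u : ℂ) ^ μ 0 := by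
  rw [Fin.prod_univ_two]
  simp only [Matrix.cons_val_zero, Matrix.cons_val_one, Units.val_one, one_zpow, mul_one]

-- (the adic `heckeAlgebra` carrier at `E_w` and the generic-`K` carrier of the ★ Satake files agree only up to instance-path unfolding; each such
--  unification is costly, whence the raised heartbeat budget — as in ★ W3-a `satakeGraph_partner_exists`; no `decide`, no search)
set_option maxHeartbeats 800000 in
/-- **`λ_β(T) = Σ_{μ ∈ supp 𝒮T} (𝒮T)_μ · ∏_i β_i^{μ_i}`** — the unramified eigencharacter at the adic place as a finite sum of Satake coefficients (★ `unitaryHeckeEigencharacterAdic_eq`,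
★ `heckeEigencharacter_apply`, Mathlib `AddMonoidAlgebra.lift_apply` through ★ `laurentEvalAt_single`), for ANY unramified datum `hd` at `w`, any rank `N`.
[cite: CartierCorvallis1979, §IV (4.2)–(4.4)] -/
theorem unitaryHeckeEigencharacterAdic_eq_sum_coeff {N : ℕ} {ϖ : w.1.adicCompletion E}
    (hd : UnramifiedLocalConjDatum (galAdicCompletionMap (L := E) c hw) ϖ) (β : Fin N → ℂˣ)
    (T : heckeAlgebra ℂ ↥(unitaryGroupOfForm (galAdicCompletionMap (L := E) c hw) ((StdForm.antidiagonal N).over (w.1.adicCompletion E)))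
      (unitaryInt (galAdicCompletionMap (L := E) c hw) ((StdForm.antidiagonal N).over (w.1.adicCompletion E)))) :
    unitaryHeckeEigencharacterAdic c hc1 v w hw hv β T =
      ∑ μ ∈ (hd.satakeTransform T).coeff.support, (hd.satakeTransform T).coeff μ * ∏ i, ((β i : ℂˣ) : ℂ) ^ μ i := by
  rw [unitaryHeckeEigencharacterAdic_eq c hc1 v w hw hv hd, hd.heckeEigencharacter_apply]
  conv_lhs => rw [← AddMonoidAlgebra.sum_coeff_single (hd.satakeTransform T)]
  rw [map_finsuppSum, Finsupp.sum]
  exact Finset.sum_congr rfl fun μ _ => laurentEvalAt_single β μ _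

-- (raised heartbeat budget: adic-carrier vs generic-`K` instance-path unification, as above and as ★ W3-a; 400000 measured insufficient; no `decide`, no search)
set_option maxHeartbeats 800000 in
/-- **B3 HEAD — SATAKE COEFFICIENTS UNDER `ξ̂_H`: THE SIGN TRANSPORT.**  At an inert place `w ∣ v` with `E_w∕F_v` unramified, for every
`φ ∈ ℋ(U(J₀,3)(E_w), K₀)`, every unramified datum `hd` at `w` and every `k ∈ ℤ`:
`(𝒮(ξ̂_H φ))_{ℓ′_k} = (−1)^k · (𝒮 φ)_{ℓ_k}`, `ℓ_k = (k, 0, −k)`, `ℓ′_k = (k, −k)` — print's `ξ̂_H(f)^∧(z) = f^∧(−z)` read on coefficients.  Proof: by ★ `graph_satakeGraphPartnerAlgHom`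
the generating functions agree, `Σ_k c′_k z^k = Σ_k c_k (−z)^k` on `ℂˣ` (both Satake transforms are supported on their rank-one lines); transport `𝒮φ` to `ℂ[ℤ²]` with the twist
`x^{ℓ_k} ↦ (−1)^k x^{ℓ′_k}`, extend the agreement from the line `{(z,1)}` to `(ℂˣ)²` (§1) and conclude with ★ `eq_of_forall_laurentEvalAt_eq`.  No power of `√q` appears: the `δ^{1∕2}`-weights are inside `𝒮` on both sides.
[cite: Rogawski1990, §4.9 p. 55] [cite: CartierCorvallis1979, §IV (4.2)–(4.4), Thm. 4.1, Cor. 4.2] -/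
theorem coeff_satakeTransform_satakeGraphPartner {ϖ : w.1.adicCompletion E}
    (hd : UnramifiedLocalConjDatum (galAdicCompletionMap (L := E) c hw) ϖ)
    (φ : heckeAlgebra ℂ ↥(unitaryGroupOfForm (galAdicCompletionMap (L := E) c hw) ((StdForm.antidiagonal 3).over (w.1.adicCompletion E)))
      (unitaryInt (galAdicCompletionMap (L := E) c hw) ((StdForm.antidiagonal 3).over (w.1.adicCompletion E)))) (k : ℤ) :
    (hd.satakeTransform (satakeGraphPartnerAlgHom c hc1 v w hw hv φ)).coeff (fun i : Fin 2 => k * (1 - 2 * ((i : ℕ) : ℤ))) =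
      (-1 : ℂ) ^ k * (hd.satakeTransform φ).coeff (fun i : Fin 3 => k * (1 - ((i : ℕ) : ℤ))) := by
  classical
  haveI := finite_residueField_adicCompletion E w.1
  -- the two Satake transforms and their antisymmetric supports
  set F₃ := hd.satakeTransform φ with hF₃
  set F₂ := hd.satakeTransform (satakeGraphPartnerAlgHom c hc1 v w hw hv φ) with hF₂
  have hanti₃ : ∀ μ, F₃.coeff μ ≠ 0 → μ = fun i : Fin 3 => μ 0 * (1 - ((i : ℕ) : ℤ)) := fun μ hμ =>
    eq_linear_three_of_rev μ fun i => by
      by_contra hne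
      exact hμ (hd.coeff_satakeTransform_eq_zero_of_ne_neg φ hne)
  have hanti₂ : ∀ μ, F₂.coeff μ ≠ 0 → μ = fun i : Fin 2 => μ 0 * (1 - 2 * ((i : ℕ) : ℤ)) := fun μ hμ =>
    eq_linear_two_of_rev μ fun i => by
      by_contra hne
      exact hμ (hd.coeff_satakeTransform_eq_zero_of_ne_neg _ hne)
  -- the twisted transport of `F₃` to `ℂ[ℤ²]`: `x^{μ} ↦ (−1)^{μ 0} x^{ℓ′(μ 0)}`
  set G : AddMonoidAlgebra ℂ (Fin 2 → ℤ) :=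
    ∑ μ ∈ F₃.coeff.support, AddMonoidAlgebra.single (fun i : Fin 2 => μ 0 * (1 - 2 * ((i : ℕ) : ℤ))) ((-1 : ℂ) ^ μ 0 * F₃.coeff μ) with hG
  -- its evaluation on the `U(2)` line is the evaluation of `F₃` on the twisted `U(3)` line
  have hevG : ∀ z : ℂˣ, laurentEvalAt ![z, 1] G = laurentEvalAt ![-z, 1, 1] F₃ := by
    intro z
    rw [hG, map_sum]
    conv_rhs => rw [← AddMonoidAlgebra.sum_coeff_single F₃, map_finsuppSum, Finsupp.sum]
    refine Finset.sum_congr rfl fun μ _ => ?_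
    rw [laurentEvalAt_single, laurentEvalAt_single, prod_zpow_param_two, prod_zpow_param_three]
    have hneg : ((-z : ℂˣ) : ℂ) = (-1 : ℂ) * (z : ℂ) := by rw [Units.val_neg, neg_one_mul]
    simp only [Fin.isValue, Fin.val_zero, Nat.cast_zero, mul_zero, sub_zero, mul_one, hneg, mul_zpow]
    ring
  -- the graph identity: `ev_{(z,1)} F₂ = ev_{(−z,1,1)} F₃ = ev_{(z,1)} G`
  have hgraph : ∀ z : ℂˣ, laurentEvalAt ![z, 1] F₂ = laurentEvalAt ![z, 1] G := by
    intro z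
    have hg := graph_satakeGraphPartnerAlgHom c hc1 v w hw hv φ z
    rw [unitaryHeckeEigencharacterAdic_eq c hc1 v w hw hv hd, unitaryHeckeEigencharacterAdic_eq c hc1 v w hw hv hd,
      hd.heckeEigencharacter_apply, hd.heckeEigencharacter_apply] at hg
    rw [hevG z]
    exact hg
  -- hence `F₂ = G` by the injectivity letter (both supported on the `U(2)` line)
  have hsuppG : ∀ ν, G.coeff ν ≠ 0 → ν = fun i : Fin 2 => ν 0 * (1 - 2 * ((i : ℕ) : ℤ)) := by
    intro ν hν
    rw [hG, AddMonoidAlgebra.coeff_sum, Finsupp.finsetSum_apply] at hν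
    obtain ⟨μ, -, hμν⟩ := Finset.exists_ne_zero_of_sum_ne_zero hν
    rw [AddMonoidAlgebra.coeff_single, Finsupp.single_apply] at hμν
    split_ifs at hμν with hμ
    · rw [← hμ]
      funext i
      simp only [Fin.isValue, Fin.val_zero, Nat.cast_zero, mul_zero, sub_zero, mul_one]
    · exact absurd rfl hμν
  have hFG : F₂ = G :=
    -- both sides are supported on the `U(1,1)` line, where they agree (`hgraph`); hence they agree on all of `(ℂˣ)²` (§1) and are equal (★)
    eq_of_forall_laurentEvalAt_eq fun β => by
      rw [laurentEvalAt_eq_laurentEvalAt_line_two F₂ hanti₂ β, laurentEvalAt_eq_laurentEvalAt_line_two G hsuppG β, hgraph]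
  -- read off the coefficient at `ℓ′_k`
  rw [hFG, hG, AddMonoidAlgebra.coeff_sum, Finsupp.finsetSum_apply]
  have hℓk : (fun i : Fin 3 => k * (1 - ((i : ℕ) : ℤ))) 0 = k := by simp
  rw [Finset.sum_eq_single (fun i : Fin 3 => k * (1 - ((i : ℕ) : ℤ)))]
  · rw [AddMonoidAlgebra.coeff_single, Finsupp.single_apply, if_pos (by rw [hℓk]), hℓk]
  · intro μ hμ hne
    rw [AddMonoidAlgebra.coeff_single, Finsupp.single_apply, if_neg]
    intro hμk
    have h0 : μ 0 = k := by
      have := congrFun hμk 0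
      simpa using this
    exact hne ((hanti₃ μ (Finsupp.mem_support_iff.1 hμ)).trans (by rw [h0]))
  · intro hk
    rw [AddMonoidAlgebra.coeff_single, Finsupp.single_apply, Finsupp.notMem_support_iff.1 hk, mul_zero, hℓk]
    simp

-- (raised heartbeat budget: the statement alone elaborates through the same adic-carrier unification as the HEAD)
set_option maxHeartbeats 800000 in
/-- **B3 in the `Int.negOnePow` spelling**: `(𝒮(ξ̂_H φ))_{ℓ′_k} = (k.negOnePow : ℂ) · (𝒮 φ)_{ℓ_k}` (Mathlib `Int.cast_negOnePow`). [cite: Rogawski1990, §4.9 p. 55]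
[cite: CartierCorvallis1979, §IV Cor. 4.2] -/
theorem coeff_satakeTransform_satakeGraphPartner_negOnePow {ϖ : w.1.adicCompletion E}
    (hd : UnramifiedLocalConjDatum (galAdicCompletionMap (L := E) c hw) ϖ)
    (φ : heckeAlgebra ℂ ↥(unitaryGroupOfForm (galAdicCompletionMap (L := E) c hw) ((StdForm.antidiagonal 3).over (w.1.adicCompletion E)))
      (unitaryInt (galAdicCompletionMap (L := E) c hw) ((StdForm.antidiagonal 3).over (w.1.adicCompletion E)))) (k : ℤ) :
    (hd.satakeTransform (satakeGraphPartnerAlgHom c hc1 v w hw hv φ)).coeff (fun i : Fin 2 => k * (1 - 2 * ((i : ℕ) : ℤ))) =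
      ((k.negOnePow : ℤ) : ℂ) * (hd.satakeTransform φ).coeff (fun i : Fin 3 => k * (1 - ((i : ℕ) : ℤ))) := by
  rw [coeff_satakeTransform_satakeGraphPartner, Int.cast_negOnePow]

end Adic

end Summit.HodgeConjecture.HodgeConjecture.R90.S6

end
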